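import Literature.Geometry.Riemannian.VolumeSphereTheoremGHDecomposition
import Literature.Geometry.Riemannian.RoundSphereDistance
import Literature.Geometry.Riemannian.VolumeSphereTheoremReifenbergProofs
import Literature.Geometry.Lorentzian.LeviCivitaProofs
import Mathlib.Geometry.Manifold.Riemannian.Basic
import Mathlib.Geometry.Euclidean.Angle.Unoriented.TriangleInequality
import Mathlib.Analysis.SpecialFunctions.Trigonometric.Bounds
import Mathlib.Topology.MetricSpace.GromovHausdorff
import HarnessLib

/-!
# Cheeger–Colding sphere stability (Thm A.1.12 at `Sⁿ`): groundwork for the named fact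
`CheegerColding1997_sphereStability`

Sibling proofs file of `VolumeSphereTheoremGHDecomposition.lean`.

STATUS OF THE DISCHARGE. `CheegerColding1997_sphereStability_holds` is NOT proved here: the
printed proof of Cheeger–Colding 1997, Thm A.1.12 (J. Differential Geom. 46 (1997), p. 459) is
"by combining Theorems A.1.1 and A.1.5" (p. 458), i.e. the intrinsic Reifenberg theorem
A.1.2/A.1.3 (pp. 457, 459–468: two `(ε, r)`-Reifenberg-flat smooth `n`-manifolds at
Gromov–Hausdorff distance `< ε(n)` are diffeomorphic) and Colding's volume convergence with
"almost maximal volume ⇒ Reifenberg point" (Thm A.1.5 = Colding, Ann. of Math. 145 (1997), on top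
of the Cheeger–Colding 1996 almost-rigidity theorems). Neither layer (nor Bishop–Gromov on the
manifold, the segment inequality, almost splitting, Gromov–Hausdorff limits of manifolds, or the
gluing of manifolds from almost-compatible charts) exists in Mathlib or `Literature/` at present;
the fact is an XL apex and stays a cited named hypothesis (its seat's NOTES.md census).

WHAT IS PROVED (the elementary layer the statement itself rests on):

§1. FINITENESS OF THE RIEMANNIAN DISTANCE ON CONNECTED MANIFOLDS. For Mathlib's length distance
`Manifold.riemannianEDist` of a continuous Riemannian bundle metric on a `C¹` manifold, the set
`{y | d(x, y) < ⊤}` is open and closed (`isOpen_setOf_riemannianEDist_lt_top`,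
`isClosed_setOf_riemannianEDist_lt_top`: Gouëzel's `eventually_riemannianEDist_lt` plus the
triangle inequality), hence on a (pre)connected manifold `d(x, y) < ∞` for all `x, y`
(`riemannianEDist_lt_top`) — the standard remark that the Riemannian distance of a connected
manifold is a genuine (finite) metric (O'Neill 1983, Ch. 5, Prop. 18; Lee 2018, Thm. 2.55), which
is what makes the `.toReal` in `IsRoundSphereGHApprox` harmless on the connected manifolds of the
fact (`riemannianEDist_lt_top_of_contMDiffRiemannianMetric`).

§2. THE GREAT-CIRCLE DISTANCE `∠(x, y) = arccos ⟪x, y⟫` ON THE UNIT SPHERE IS A METRIC comparable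
with the chordal one: `‖x − y‖ ≤ ∠(x, y) ≤ (π/2) ‖x − y‖` for unit vectors
(`norm_sub_le_angle`, `angle_le_pi_div_two_mul_norm_sub`, through `‖x − y‖ = 2 sin(∠/2)`,
`norm_sub_eq_two_mul_sin_half_angle`), definiteness `∠(x, y) = 0 ↔ x = y` on the sphere
(`angle_eq_zero_iff_of_mem_sphere`), and the triangle inequality is Mathlib's
`InnerProductGeometry.angle_le_angle_add_angle`. [folklore]

§3. API OF `IsRoundSphereGHApprox` (Colding 1997 *Aspects*, Def. 2.1): monotonicity in `ε`,
`0 ≤ ε`, non-emptiness of `M`, the distortion and density inequalities unfolded, and the diameter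
bound `d_h(a, b) ≤ π + ε` (`IsRoundSphereGHApprox.toReal_riemannianEDist_le`).

§4. THE RENDERING VERSUS MATHLIB'S GROMOV–HAUSDORFF DISTANCE. The Riemannian distance of a
connected `T₃` manifold as a `MetricSpace` structure inducing the manifold topology
(`metricSpaceOfRiemannian`: Gouëzel's `EMetricSpace.ofRiemannianMetric` made real-valued by §1);
the unit sphere with its great-circle distance as a compact metric space `GreatCircleSphere n`
(`dist = ∠`, topology = the usual one by §2); and the theorem that an `ε`-approximation in the
sense of `IsRoundSphereGHApprox` gives `d_GH((M, d_h), (Sⁿ, ∠)) ≤ 3ε/2` for Mathlib's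
`GromovHausdorff.ghDist` (`IsRoundSphereGHApprox.ghDist_le`, from Mathlib's
`ghDist_le_of_approx_subsets`) — the direction "tree rendering ⇒ printed `d_GH`-closeness" of
the remark after Colding 1997 *Aspects*, Def. 2.1, used in the faithfulness discussion of the
statement file.

§5. THE MODEL CASE (non-vacuity of the fact). With `roundSphereMetric n` — the tree's round metric
`roundMetric` of `Sⁿ ⊂ ℝⁿ⁺¹` (`RoundSphere.lean`) as a Mathlib `ContMDiffRiemannianMetric`, the
class of metrics the fact quantifies over — the unit round sphere satisfies, for `n ≥ 1` and every
`ε ≥ 0`, BOTH hypotheses of `CheegerColding1997_sphereStability`: the Ricci bound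
`Ric ≥ −(n − 1) g` (`ricci_roundSphereMetric_ge`, from `Ric = (n − 1) g`,
`ricci_roundMetric_holds` of `RoundSphereProofs.lean`, the Levi-Civita hypothesis being
`PseudoRiemannianMetric.hasLeviCivita`) and the Gromov–Hausdorff hypothesis with `f = id`
(`isRoundSphereGHApprox_roundSphere`: a `0`-approximation, because the length distance of the
round metric IS the angle, `riemannianEDist_roundSphere` of `RoundSphereDistance.lean`), and of
course the conclusion (`Diffeomorph.refl`): `CheegerColding1997_sphereStability_modelCase`.

§6. THE CONVERSE DIRECTION OF §4: if Mathlib's Gromov–Hausdorff distance between `(M, d_h)` and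
`(Sⁿ, ∠)` is `< ε`, then `M` admits a `2ε`-approximation to the round sphere in the sense of
`IsRoundSphereGHApprox` (`exists_isRoundSphereGHApprox_of_ghDist_lt`, through the optimal common
isometric embedding, `exists_approx_pair_of_ghDist_lt` of `VolumeSphereTheoremReifenbergProofs`).
With §4 this makes the tree's rendering of "`d_GH(M, Sⁿ) ≲ ε`" EQUIVALENT to the printed one up to
the constants `3/2` and `2`, which the quantifiers `∃ ε` / `∀ ε ∃ δ` of the facts absorb.

## References

* J. Cheeger, T. H. Colding, *On the structure of spaces with Ricci curvature bounded below. I*,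
  J. Differential Geom. 46 (1997) 406–480, Appendix 1: Thms A.1.1–A.1.3 (p. 457), A.1.5, A.1.8
  (p. 458), A.1.9–A.1.12 (p. 459). [CheegerColding1997]
* T. H. Colding, *Aspects of Ricci curvature*, Comparison Geometry, MSRI Publ. 30 (1997), Def. 2.1.
  [Colding1997Aspects]
* B. O'Neill, *Semi-Riemannian geometry* (1983), Ch. 5, Def. 15, Prop. 18. [ONeill1983]
-/

noncomputable section

open Set Filter Manifold Bundle InnerProductGeometry
open scoped Manifold ContDiff ENNReal Topology RealInnerProductSpace

namespace Literature.Geometry.Riemannian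

/-! ### §1. Finiteness of the Riemannian distance on connected manifolds -/

section Finite

variable {E : Type*} [NormedAddCommGroup E] [NormedSpace ℝ E] {H : Type*} [TopologicalSpace H]
  {I : ModelWithCorners ℝ E H} {M : Type*} [TopologicalSpace M] [ChartedSpace H M]
  [RiemannianBundle (fun x : M ↦ TangentSpace I x)] [IsManifold I 1 M]
  [IsContinuousRiemannianBundle E (fun x : M ↦ TangentSpace I x)]

variable (I) in
/-- The set of points at finite Riemannian distance from `x` is open: a point close to `y` in the
topology is close to `y` in Riemannian distance (Mathlib's `eventually_riemannianEDist_lt`), and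
the triangle inequality. (O'Neill 1983, Ch. 5, Prop. 18.) [folklore] -/
theorem isOpen_setOf_riemannianEDist_lt_top (x : M) :
    IsOpen {y : M | riemannianEDist I x y < ⊤} := by
  rw [isOpen_iff_mem_nhds]
  intro y hy
  filter_upwards [eventually_riemannianEDist_lt I y zero_lt_one] with z hz
  calc riemannianEDist I x z ≤ riemannianEDist I x y + riemannianEDist I y z :=
        riemannianEDist_triangle
    _ < ⊤ := ENNReal.add_lt_top.2 ⟨hy, hz.trans ENNReal.one_lt_top⟩

variable (I) in
/-- The set of points at finite Riemannian distance from `x` is closed (its complement is open,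
by the same argument). (O'Neill 1983, Ch. 5, Prop. 18.) [folklore] -/
theorem isClosed_setOf_riemannianEDist_lt_top (x : M) :
    IsClosed {y : M | riemannianEDist I x y < ⊤} := by
  rw [← isOpen_compl_iff, isOpen_iff_mem_nhds]
  intro y hy
  filter_upwards [eventually_riemannianEDist_lt I y zero_lt_one] with z hz
  simp only [mem_compl_iff, mem_setOf_eq, not_lt, top_le_iff] at hy ⊢
  by_contra hxz
  have hlt : riemannianEDist I x y < ⊤ :=
    calc riemannianEDist I x y ≤ riemannianEDist I x z + riemannianEDist I z y :=
          riemannianEDist_triangle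
      _ < ⊤ := ENNReal.add_lt_top.2
          ⟨lt_top_iff_ne_top.2 hxz, by rw [riemannianEDist_comm]; exact hz.trans ENNReal.one_lt_top⟩
  exact hlt.ne hy

variable (I) in
/-- **On a connected Riemannian manifold the Riemannian distance is finite**: any two points are
joined by a `C¹` path of finite length (the set of points at finite distance from `x` is clopen and
contains `x`). (O'Neill 1983, Ch. 5, Prop. 18; Lee, *Riemannian Manifolds*, Thm. 2.55.)
[folklore] -/
theorem riemannianEDist_lt_top [PreconnectedSpace M] (x y : M) : riemannianEDist I x y < ⊤ := by
  have hclopen : IsClopen {y : M | riemannianEDist I x y < ⊤} :=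
    ⟨isClosed_setOf_riemannianEDist_lt_top I x, isOpen_setOf_riemannianEDist_lt_top I x⟩
  have hx : x ∈ {y : M | riemannianEDist I x y < ⊤} := by
    simp [riemannianEDist_self]
  have huniv := hclopen.eq_univ ⟨x, hx⟩
  have hy : y ∈ {y : M | riemannianEDist I x y < ⊤} := by rw [huniv]; trivial
  exact hy

variable (I) in
/-- Finite Riemannian distance, `≠ ∞` form. [folklore] -/
theorem riemannianEDist_ne_top [PreconnectedSpace M] (x y : M) : riemannianEDist I x y ≠ ⊤ :=
  (riemannianEDist_lt_top I x y).ne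

end Finite

/-! ### §1'. The setting of the fact: a `C^∞` Riemannian metric on a connected `n`-manifold -/

section Setting

variable {n : ℕ} {M : Type*} [TopologicalSpace M] [ChartedSpace (EuclideanSpace ℝ (Fin n)) M]
  [IsManifold (𝓡 n) ∞ M]

/-- In the setting of `CheegerColding1997_sphereStability` (a `C^∞` Riemannian metric `h` on the
tangent bundle of a connected manifold, the norms on the tangent spaces being those of `h` as in
`IsRoundSphereGHApprox`), the length distance `d_h = riemannianEDist` is finite. [folklore] -/
theorem riemannianEDist_lt_top_of_contMDiffRiemannianMetric [PreconnectedSpace M]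
    (h : ContMDiffRiemannianMetric (𝓡 n) ∞ (EuclideanSpace ℝ (Fin n))
      (TangentSpace (𝓡 n) : M → Type _)) (a b : M) :
    letI : RiemannianBundle (fun x : M ↦ TangentSpace (𝓡 n) x) :=
      ⟨h.toContinuousRiemannianMetric.toRiemannianMetric⟩
    riemannianEDist (𝓡 n) a b < ⊤ := by
  letI : RiemannianBundle (fun x : M ↦ TangentSpace (𝓡 n) x) :=
    ⟨h.toContinuousRiemannianMetric.toRiemannianMetric⟩
  exact riemannianEDist_lt_top (𝓡 n) a b

end Setting

/-! ### §2. The great-circle distance on the unit sphere -/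

section Angle

variable {V : Type*} [NormedAddCommGroup V] [InnerProductSpace ℝ V]

/-- For unit vectors, `‖x − y‖² = 2 − 2 cos ∠(x, y)`. [folklore] -/
theorem norm_sub_sq_eq_two_sub_two_mul_cos_angle {x y : V} (hx : ‖x‖ = 1) (hy : ‖y‖ = 1) :
    ‖x - y‖ ^ 2 = 2 - 2 * Real.cos (angle x y) := by
  rw [@norm_sub_sq_real, inner_eq_cos_angle_of_norm_eq_one hx hy, hx, hy]
  ring

/-- For unit vectors, the chord is `‖x − y‖ = 2 sin(∠(x, y)/2)`. [folklore] -/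
theorem norm_sub_eq_two_mul_sin_half_angle {x y : V} (hx : ‖x‖ = 1) (hy : ‖y‖ = 1) :
    ‖x - y‖ = 2 * Real.sin (angle x y / 2) := by
  have h0 : 0 ≤ Real.sin (angle x y / 2) := by
    apply Real.sin_nonneg_of_nonneg_of_le_pi
    · linarith [angle_nonneg x y]
    · linarith [angle_le_pi x y, Real.pi_pos]
  have hsq : ‖x - y‖ ^ 2 = (2 * Real.sin (angle x y / 2)) ^ 2 := by
    rw [norm_sub_sq_eq_two_sub_two_mul_cos_angle hx hy]
    have hc : Real.cos (angle x y) = 1 - 2 * Real.sin (angle x y / 2) ^ 2 := by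
      have h2 := Real.cos_two_mul (angle x y / 2)
      rw [show 2 * (angle x y / 2) = angle x y by ring] at h2
      linarith [Real.sin_sq_add_cos_sq (angle x y / 2)]
    rw [hc]
    ring
  have h1 : 0 ≤ 2 * Real.sin (angle x y / 2) := by positivity
  exact (sq_eq_sq₀ (norm_nonneg _) h1).1 hsq

/-- **Chord ≤ arc**: for unit vectors `‖x − y‖ ≤ ∠(x, y)` (`sin t ≤ t`). [folklore] -/
theorem norm_sub_le_angle {x y : V} (hx : ‖x‖ = 1) (hy : ‖y‖ = 1) : ‖x - y‖ ≤ angle x y := by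
  rw [norm_sub_eq_two_mul_sin_half_angle hx hy]
  have := Real.sin_le (show 0 ≤ angle x y / 2 by linarith [angle_nonneg x y])
  linarith

/-- **Arc ≤ (π/2) · chord**: for unit vectors `∠(x, y) ≤ (π/2) ‖x − y‖` (Jordan's inequality
`(2/π) t ≤ sin t` on `[0, π/2]`). [folklore] -/
theorem angle_le_pi_div_two_mul_norm_sub {x y : V} (hx : ‖x‖ = 1) (hy : ‖y‖ = 1) :
    angle x y ≤ Real.pi / 2 * ‖x - y‖ := by
  rw [norm_sub_eq_two_mul_sin_half_angle hx hy]
  have h1 : 0 ≤ angle x y / 2 := by linarith [angle_nonneg x y]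
  have h2 : angle x y / 2 ≤ Real.pi / 2 := by linarith [angle_le_pi x y]
  have hJ := Real.mul_le_sin h1 h2
  have hπ : 0 < Real.pi := Real.pi_pos
  -- `(2/π)(θ/2) ≤ sin(θ/2)` ⇒ `θ ≤ π sin(θ/2) = (π/2)(2 sin(θ/2))`
  have key : Real.pi * (2 / Real.pi * (angle x y / 2)) ≤ Real.pi * Real.sin (angle x y / 2) :=
    mul_le_mul_of_nonneg_left hJ hπ.le
  have e : Real.pi * (2 / Real.pi * (angle x y / 2)) = angle x y := by
    field_simp
  rw [e] at key
  calc angle x y ≤ Real.pi * Real.sin (angle x y / 2) := key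
    _ = Real.pi / 2 * (2 * Real.sin (angle x y / 2)) := by ring

/-- On the unit sphere the angle is definite: `∠(x, y) = 0 ↔ x = y`. [folklore] -/
theorem angle_eq_zero_iff_of_norm_eq_one {x y : V} (hx : ‖x‖ = 1) (hy : ‖y‖ = 1) :
    angle x y = 0 ↔ x = y := by
  constructor
  · intro h
    have h' : ‖x - y‖ ≤ 0 := by simpa [h] using norm_sub_le_angle hx hy
    have : ‖x - y‖ = 0 := le_antisymm h' (norm_nonneg _)
    exact sub_eq_zero.1 (norm_eq_zero.1 this)
  · rintro rfl
    exact angle_self (by rintro rfl; simp at hx)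

omit [InnerProductSpace ℝ V] in
/-- Points of the unit sphere are unit vectors. [folklore] -/
theorem norm_eq_one_of_mem_sphere (x : Metric.sphere (0 : V) 1) : ‖(x : V)‖ = 1 :=
  mem_sphere_zero_iff_norm.1 x.2

end Angle

/-! ### §3. API of `IsRoundSphereGHApprox` -/

namespace IsRoundSphereGHApprox

variable {n : ℕ} {M : Type} [TopologicalSpace M] [ChartedSpace (EuclideanSpace ℝ (Fin n)) M]
  [IsManifold (𝓡 n) ∞ M]
  {h : ContMDiffRiemannianMetric (𝓡 n) ∞ (EuclideanSpace ℝ (Fin n))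
    (TangentSpace (𝓡 n) : M → Type _)}
  {ε ε' : ℝ} {f : M → Metric.sphere (0 : EuclideanSpace ℝ (Fin (n + 1))) 1}

/-- A point of the unit sphere `Sⁿ ⊂ ℝⁿ⁺¹` (the first coordinate vector). [folklore] -/
def basePoint (n : ℕ) : Metric.sphere (0 : EuclideanSpace ℝ (Fin (n + 1))) 1 :=
  ⟨EuclideanSpace.single (0 : Fin (n + 1)) (1 : ℝ), by simp⟩

/-- The distortion inequality of an `ε`-approximation, unfolded. [cite: Colding1997Aspects, Def. 2.1] -/
theorem abs_angle_sub_le (hf : IsRoundSphereGHApprox n h ε f) (a b : M) :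
    letI : RiemannianBundle (fun x : M ↦ TangentSpace (𝓡 n) x) :=
      ⟨h.toContinuousRiemannianMetric.toRiemannianMetric⟩
    |angle (f a : EuclideanSpace ℝ (Fin (n + 1))) (f b) - (riemannianEDist (𝓡 n) a b).toReal| ≤ ε :=
  hf.1 a b

/-- The density of the image of an `ε`-approximation, unfolded. [cite: Colding1997Aspects, Def. 2.1] -/
theorem exists_angle_le (hf : IsRoundSphereGHApprox n h ε f)
    (y : Metric.sphere (0 : EuclideanSpace ℝ (Fin (n + 1))) 1) :
    ∃ a : M, angle (f a : EuclideanSpace ℝ (Fin (n + 1))) y ≤ ε :=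
  hf.2 y

/-- An `ε`-approximation has `0 ≤ ε` (the image is `ε`-dense in the nonempty sphere). [folklore] -/
theorem nonneg (hf : IsRoundSphereGHApprox n h ε f) : 0 ≤ ε := by
  obtain ⟨a, ha⟩ := hf.2 (basePoint n)
  exact (angle_nonneg _ _).trans ha

/-- A manifold admitting an `ε`-approximation to the sphere is nonempty. [folklore] -/
theorem nonempty (hf : IsRoundSphereGHApprox n h ε f) : Nonempty M := by
  obtain ⟨a, _⟩ := hf.2 (basePoint n)
  exact ⟨a⟩

/-- Monotonicity: an `ε`-approximation is an `ε'`-approximation for `ε ≤ ε'`. [folklore] -/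
theorem mono (hf : IsRoundSphereGHApprox n h ε f) (hε : ε ≤ ε') : IsRoundSphereGHApprox n h ε' f :=
  ⟨fun a b ↦ (hf.1 a b).trans hε, fun y ↦ (hf.2 y).imp fun _ ha ↦ ha.trans hε⟩

/-- The angle between image points controls the Riemannian distance:
`d_h(a, b) ≤ ∠(f a, f b) + ε` (real form). [cite: Colding1997Aspects, Def. 2.1] -/
theorem toReal_riemannianEDist_le_angle_add (hf : IsRoundSphereGHApprox n h ε f) (a b : M) :
    letI : RiemannianBundle (fun x : M ↦ TangentSpace (𝓡 n) x) :=
      ⟨h.toContinuousRiemannianMetric.toRiemannianMetric⟩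
    (riemannianEDist (𝓡 n) a b).toReal ≤
      angle (f a : EuclideanSpace ℝ (Fin (n + 1))) (f b) + ε := by
  have := abs_le.1 (hf.1 a b)
  linarith [this.1]

/-- Conversely `∠(f a, f b) ≤ d_h(a, b) + ε`. [cite: Colding1997Aspects, Def. 2.1] -/
theorem angle_le_toReal_riemannianEDist_add (hf : IsRoundSphereGHApprox n h ε f) (a b : M) :
    letI : RiemannianBundle (fun x : M ↦ TangentSpace (𝓡 n) x) :=
      ⟨h.toContinuousRiemannianMetric.toRiemannianMetric⟩
    angle (f a : EuclideanSpace ℝ (Fin (n + 1))) (f b) ≤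
      (riemannianEDist (𝓡 n) a b).toReal + ε := by
  have := abs_le.1 (hf.1 a b)
  linarith [this.2]

/-- **Diameter bound**: a manifold `ε`-approximating the unit sphere has `d_h(a, b) ≤ π + ε` for
all `a, b` (real form; `∠ ≤ π`). [folklore] -/
theorem toReal_riemannianEDist_le (hf : IsRoundSphereGHApprox n h ε f) (a b : M) :
    letI : RiemannianBundle (fun x : M ↦ TangentSpace (𝓡 n) x) :=
      ⟨h.toContinuousRiemannianMetric.toRiemannianMetric⟩
    (riemannianEDist (𝓡 n) a b).toReal ≤ Real.pi + ε :=
  (hf.toReal_riemannianEDist_le_angle_add a b).trans (by gcongr; exact angle_le_pi _ _)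

/-- **Diameter bound, extended form**: on a connected manifold (where `d_h < ∞`,
`riemannianEDist_lt_top`) an `ε`-approximation to the unit sphere forces
`d_h(a, b) ≤ π + ε` in `ℝ≥0∞`. [folklore] -/
theorem riemannianEDist_le [PreconnectedSpace M] (hf : IsRoundSphereGHApprox n h ε f) (a b : M) :
    letI : RiemannianBundle (fun x : M ↦ TangentSpace (𝓡 n) x) :=
      ⟨h.toContinuousRiemannianMetric.toRiemannianMetric⟩
    riemannianEDist (𝓡 n) a b ≤ ENNReal.ofReal (Real.pi + ε) := by
  letI : RiemannianBundle (fun x : M ↦ TangentSpace (𝓡 n) x) :=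
    ⟨h.toContinuousRiemannianMetric.toRiemannianMetric⟩
  have hfin : riemannianEDist (𝓡 n) a b ≠ ⊤ := riemannianEDist_ne_top (𝓡 n) a b
  rw [← ENNReal.ofReal_toReal hfin]
  exact ENNReal.ofReal_le_ofReal (hf.toReal_riemannianEDist_le a b)

end IsRoundSphereGHApprox

/-! ### §4. `(Sⁿ, ∠)` as a compact metric space, the Riemannian distance as a metric space
structure, and `IsRoundSphereGHApprox` versus Mathlib's Gromov–Hausdorff distance -/

section MetricSpaceOfRiemannian

variable {E : Type*} [NormedAddCommGroup E] [NormedSpace ℝ E] {H : Type*} [TopologicalSpace H]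
  {I : ModelWithCorners ℝ E H} {M : Type*} [TopologicalSpace M] [ChartedSpace H M]
  [RiemannianBundle (fun x : M ↦ TangentSpace I x)] [IsManifold I 1 M]
  [IsContinuousRiemannianBundle E (fun x : M ↦ TangentSpace I x)]

variable (I M) in
/-- **The Riemannian distance of a connected `T₃` Riemannian manifold as a metric space
structure** inducing the manifold topology: Mathlib's `EMetricSpace.ofRiemannianMetric`
(Gouëzel) made real-valued through finiteness of the distance on connected manifolds
(`riemannianEDist_ne_top`). A `def` to be activated with `letI`; the topology is definitionally
the manifold topology. (O'Neill 1983, Ch. 5, Prop. 18: "`d` is a metric … compatible with the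
topology of `M`".) [cite: ONeill1983, Ch. 5, Prop. 18] -/
@[reducible] def metricSpaceOfRiemannian [T3Space M] [PreconnectedSpace M] : MetricSpace M :=
  letI : EMetricSpace M := .ofRiemannianMetric I M
  EMetricSpace.toMetricSpace fun x y ↦ riemannianEDist_ne_top I x y

/-- The distance of `metricSpaceOfRiemannian` is the (real part of the) Riemannian distance.
[folklore] -/
theorem dist_metricSpaceOfRiemannian [T3Space M] [PreconnectedSpace M] (x y : M) :
    letI := metricSpaceOfRiemannian I M
    dist x y = (riemannianEDist I x y).toReal :=
  rfl

end MetricSpaceOfRiemannian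

/-- The unit sphere `Sⁿ ⊂ ℝⁿ⁺¹` as a type synonym, to be equipped with the GREAT-CIRCLE (intrinsic,
angular) distance `∠(x, y) = arccos ⟪x, y⟫` — the distance of the unit round sphere to which
`IsRoundSphereGHApprox` refers — instead of the chordal distance of the subtype. [folklore] -/
def GreatCircleSphere (n : ℕ) : Type :=
  Metric.sphere (0 : EuclideanSpace ℝ (Fin (n + 1))) 1

namespace GreatCircleSphere

variable {n : ℕ}

/-- The identification of Mathlib's unit sphere with `GreatCircleSphere n`. [folklore] -/
def ofSphere : Metric.sphere (0 : EuclideanSpace ℝ (Fin (n + 1))) 1 ≃ GreatCircleSphere n :=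
  Equiv.refl _

/-- The underlying unit vector of a point of `GreatCircleSphere n`. [folklore] -/
def val (x : GreatCircleSphere n) : EuclideanSpace ℝ (Fin (n + 1)) :=
  ((ofSphere.symm x : Metric.sphere (0 : EuclideanSpace ℝ (Fin (n + 1))) 1) :
    EuclideanSpace ℝ (Fin (n + 1)))

/-- `val ∘ ofSphere` is the inclusion of the sphere. [folklore] -/
@[simp] theorem val_ofSphere (x : Metric.sphere (0 : EuclideanSpace ℝ (Fin (n + 1))) 1) :
    (ofSphere x).val = x := rfl

/-- Points of `GreatCircleSphere n` are unit vectors. [folklore] -/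
theorem norm_val (x : GreatCircleSphere n) : ‖x.val‖ = 1 :=
  norm_eq_one_of_mem_sphere (ofSphere.symm x)

/-- `val` is injective. [folklore] -/
theorem val_injective : Function.Injective (val : GreatCircleSphere n → _) :=
  fun _ _ h ↦ Subtype.val_injective h

/-- The topology of `GreatCircleSphere n`: that of the subtype `Sⁿ ⊂ ℝⁿ⁺¹` (which the great-circle
metric induces, `isOpen_iff_angle`). [folklore] -/
instance : TopologicalSpace (GreatCircleSphere n) :=
  inferInstanceAs (TopologicalSpace (Metric.sphere (0 : EuclideanSpace ℝ (Fin (n + 1))) 1))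

/-- `GreatCircleSphere n` is compact (the unit sphere of a finite-dimensional space). [folklore] -/
instance : CompactSpace (GreatCircleSphere n) :=
  inferInstanceAs (CompactSpace (Metric.sphere (0 : EuclideanSpace ℝ (Fin (n + 1))) 1))

/-- `GreatCircleSphere n` is nonempty. [folklore] -/
instance : Nonempty (GreatCircleSphere n) := ⟨ofSphere (IsRoundSphereGHApprox.basePoint n)⟩

/-- In the (chordal) subtype topology of the sphere, a set is open iff it contains a great-circle
ball about each of its points: the two distances are comparable,
`‖x − y‖ ≤ ∠(x, y) ≤ (π/2)‖x − y‖`. [folklore] -/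
theorem isOpen_iff_angle (s : Set (GreatCircleSphere n)) :
    IsOpen s ↔ ∀ x ∈ s, ∃ ε > 0, ∀ y, angle x.val y.val < ε → y ∈ s := by
  refine (Metric.isOpen_iff (α := Metric.sphere (0 : EuclideanSpace ℝ (Fin (n + 1))) 1)
    (s := s)).trans (forall₂_congr fun x _ ↦ ⟨fun ⟨ε, hε, hb⟩ ↦ ⟨ε, hε, fun y hy ↦ ?_⟩,
      fun ⟨ε, hε, hb⟩ ↦ ⟨2 / Real.pi * ε, by positivity, fun y hy ↦ ?_⟩⟩)
  · -- chord ≤ arc: the chordal `ε`-ball contains the angular `ε`-ball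
    refine hb (a := ofSphere.symm y) ?_
    rw [Metric.mem_ball, dist_comm, Subtype.dist_eq, dist_eq_norm]
    exact (norm_sub_le_angle (norm_val x) (norm_val y)).trans_lt hy
  · -- arc ≤ (π/2) chord: the angular `ε`-ball contains the chordal `(2/π) ε`-ball
    rw [Metric.mem_ball, dist_comm, Subtype.dist_eq, dist_eq_norm] at hy
    refine hb (ofSphere y)
      ((angle_le_pi_div_two_mul_norm_sub (norm_val x) (norm_val (ofSphere y))).trans_lt ?_)
    calc Real.pi / 2 * ‖val x - val (ofSphere y)‖ < Real.pi / 2 * (2 / Real.pi * ε) := by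
          gcongr; exact hy
      _ = ε := by field_simp

/-- **The great-circle metric on `Sⁿ`**: `dist x y = ∠(x, y)`, a metric (triangle inequality:
Mathlib's `InnerProductGeometry.angle_le_angle_add_angle`; definiteness:
`angle_eq_zero_iff_of_norm_eq_one`) inducing the usual topology of the sphere
(`isOpen_iff_angle`). [folklore] -/
instance : MetricSpace (GreatCircleSphere n) :=
  MetricSpace.ofDistTopology (fun x y ↦ angle x.val y.val)
    (fun x ↦ angle_self (by
      intro h0
      have := x.norm_val
      rw [h0, norm_zero] at this
      exact zero_ne_one this))
    (fun x y ↦ angle_comm _ _)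
    (fun x y z ↦ angle_le_angle_add_angle _ _ _)
    isOpen_iff_angle
    (fun x y hxy ↦ val_injective ((angle_eq_zero_iff_of_norm_eq_one x.norm_val y.norm_val).1 hxy))

/-- The distance of `GreatCircleSphere n` is the angle. [folklore] -/
theorem dist_eq (x y : GreatCircleSphere n) : dist x y = angle x.val y.val := rfl

/-- The great-circle sphere has diameter at most `π`. [folklore] -/
theorem dist_le_pi (x y : GreatCircleSphere n) : dist x y ≤ Real.pi := angle_le_pi _ _

end GreatCircleSphere

/-- **`IsRoundSphereGHApprox` controls the Gromov–Hausdorff distance.** If the compact connected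
Riemannian manifold `(M, h)` admits an `ε`-Gromov–Hausdorff approximation to the unit round
sphere in the sense of `IsRoundSphereGHApprox` (distortion `≤ ε` against the great-circle
distance, `ε`-dense image), then Mathlib's Gromov–Hausdorff distance between `(M, d_h)` (the
metric space `metricSpaceOfRiemannian` of the length distance of `h`) and `(Sⁿ, ∠)`
(`GreatCircleSphere n`) is at most `3ε/2` — Mathlib's `GromovHausdorff.ghDist_le_of_approx_subsets`
with `s = M`. This is the direction "the tree's rendering ⇒ the printed `d_GH`-closeness" of the
remark after Colding 1997 *Aspects*, Def. 2.1. [cite: Colding1997Aspects, Def. 2.1 and the remark following it] -/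
theorem IsRoundSphereGHApprox.ghDist_le {n : ℕ} {M : Type} [TopologicalSpace M] [T2Space M]
    [ChartedSpace (EuclideanSpace ℝ (Fin n)) M] [IsManifold (𝓡 n) ∞ M] [CompactSpace M]
    [ConnectedSpace M]
    {h : ContMDiffRiemannianMetric (𝓡 n) ∞ (EuclideanSpace ℝ (Fin n))
      (TangentSpace (𝓡 n) : M → Type _)}
    {ε : ℝ} {f : M → Metric.sphere (0 : EuclideanSpace ℝ (Fin (n + 1))) 1}
    (hf : IsRoundSphereGHApprox n h ε f) :
    letI : RiemannianBundle (fun x : M ↦ TangentSpace (𝓡 n) x) :=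
      ⟨h.toContinuousRiemannianMetric.toRiemannianMetric⟩
    letI : MetricSpace M := metricSpaceOfRiemannian (𝓡 n) M
    GromovHausdorff.ghDist M (GreatCircleSphere n) ≤ 3 / 2 * ε := by
  letI : RiemannianBundle (fun x : M ↦ TangentSpace (𝓡 n) x) :=
    ⟨h.toContinuousRiemannianMetric.toRiemannianMetric⟩
  letI : MetricSpace M := metricSpaceOfRiemannian (𝓡 n) M
  have H := GromovHausdorff.ghDist_le_of_approx_subsets (X := M) (Y := GreatCircleSphere n)
    (s := Set.univ) (fun p ↦ GreatCircleSphere.ofSphere (f p.1)) (ε₁ := 0) (ε₂ := ε) (ε₃ := ε)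
    (fun x ↦ ⟨x, Set.mem_univ _, by simp⟩) (fun y ↦ ?_) (fun a b ↦ ?_)
  · linarith
  · obtain ⟨a, ha⟩ := hf.2 (GreatCircleSphere.ofSphere.symm y)
    refine ⟨⟨a, Set.mem_univ _⟩, ?_⟩
    rw [GreatCircleSphere.dist_eq, angle_comm]
    exact ha
  · have hab := hf.1 a b
    rw [abs_sub_comm] at hab
    rw [GreatCircleSphere.dist_eq, Subtype.dist_eq, dist_metricSpaceOfRiemannian]
    exact hab

/-! ### §5. The model case: the round sphere satisfies the hypotheses (and the conclusion) of the fact -/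

section ModelCase

open Lorentzian Lorentzian.PseudoRiemannianMetric Manifold Bundle Metric Module
open scoped EuclideanSpace

variable {n : ℕ}

/-- The round metric of `Sⁿ ⊂ ℝⁿ⁺¹` as a Mathlib `ContMDiffRiemannianMetric` on the tangent bundle of
Mathlib's sphere — the class of metrics over which `CheegerColding1997_sphereStability`
quantifies (`PseudoRiemannianMetric.toContMDiffRiemannianMetric` of the tree's `roundMetric`).
[cite: ONeill1983, Ch. 3, Def. 3.4 and p. 57] -/
abbrev roundSphereMetric (n : ℕ) :
    ContMDiffRiemannianMetric (𝓡 n) ∞ (EuclideanSpace ℝ (Fin n))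
      (TangentSpace (𝓡 n) : sphere (0 : EuclideanSpace ℝ (Fin (n + 1))) 1 → Type _) :=
  (roundMetric (n := n) (EuclideanSpace ℝ (Fin (n + 1)))).toContMDiffRiemannianMetric
    isRiemannian_roundMetric

/-- **The round sphere satisfies the Gromov–Hausdorff hypothesis of the fact with `ε = 0`**: for
`n ≥ 1` the identity of `Sⁿ` is a `0`-Gromov–Hausdorff approximation from `(Sⁿ, g_round)` to
`(Sⁿ, ∠)` in the sense of `IsRoundSphereGHApprox` — its length distance IS the angle
(`riemannianEDist_roundSphere`). In particular the metric hypothesis of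
`CheegerColding1997_sphereStability` is satisfiable for every `ε ≥ 0` (by `IsRoundSphereGHApprox.mono`),
so the fact is not vacuous on that side. [folklore] -/
theorem isRoundSphereGHApprox_roundSphere (hn : 1 ≤ n) :
    IsRoundSphereGHApprox n (roundSphereMetric n) 0 id := by
  refine ⟨fun a b ↦ ?_, fun y ↦ ⟨y, le_of_eq (angle_self (ne_zero_of_mem_unit_sphere y))⟩⟩
  have h : (letI : RiemannianBundle (fun x : sphere (0 : EuclideanSpace ℝ (Fin (n + 1))) 1 ↦
      TangentSpace (𝓡 n) x) :=
        ⟨(roundSphereMetric n).toContinuousRiemannianMetric.toRiemannianMetric⟩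
      riemannianEDist (𝓡 n) a b) =
      ENNReal.ofReal (angle (a : EuclideanSpace ℝ (Fin (n + 1))) b) :=
    riemannianEDist_roundSphere (V := EuclideanSpace ℝ (Fin (n + 1))) hn a b
  simp only [id]
  rw [h, ENNReal.toReal_ofReal (angle_nonneg _ _), sub_self, abs_zero]


/-- `ofRiemannian` of `roundSphereMetric n` is the tree's `roundMetric` (structure eta). [folklore] -/
theorem ofRiemannian_roundSphereMetric :
    ofRiemannian (roundSphereMetric n) = roundMetric (n := n) (EuclideanSpace ℝ (Fin (n + 1))) :=
  rfl

/-- The Levi-Civita standing hypothesis for the round sphere metric (every `C^∞` metric has it,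
`PseudoRiemannianMetric.hasLeviCivita`). [cite: ONeill1983, Ch. 3, Thm. 3.11] -/
instance instHasLeviCivitaOfRiemannianRoundSphereMetric :
    (ofRiemannian (roundSphereMetric n)).HasLeviCivita :=
  (ofRiemannian (roundSphereMetric n)).hasLeviCivita

/-- **The Ricci hypothesis of the fact holds for the round sphere**: `Ric = (n − 1) g ≥ −(n − 1) g`
(`ricci_roundMetric_holds`, `isLeviCivita_leviCivita_holds`; `n ≥ 1`). [cite: Topping2006, §1.2.1] -/
theorem ricci_roundSphereMetric_ge (hn : 1 ≤ n) (x : sphere (0 : EuclideanSpace ℝ (Fin (n + 1))) 1)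
    (v : TangentSpace (𝓡 n) x) :
    -((n : ℝ) - 1) * (roundSphereMetric n).inner x v v ≤
      (ofRiemannian (roundSphereMetric n)).ricci x v v := by
  haveI : (roundMetric (n := n) (EuclideanSpace ℝ (Fin (n + 1)))).HasLeviCivita :=
    instHasLeviCivitaOfRiemannianRoundSphereMetric
  have hLC : (roundMetric (n := n) (EuclideanSpace ℝ (Fin (n + 1)))).IsLeviCivita
      (roundMetric (n := n) (EuclideanSpace ℝ (Fin (n + 1)))).leviCivita :=
    isLeviCivita_leviCivita_holds
  have hR := ricci_roundMetric_holds (EuclideanSpace ℝ (Fin (n + 1))) n _ hLC x v v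
  have h1 : (ofRiemannian (roundSphereMetric n)).ricci x v v =
      ((n : ℝ) - 1) * (roundSphereMetric n).inner x v v := hR
  rw [h1]
  have h0 : 0 ≤ (roundSphereMetric n).inner x v v := by
    show 0 ≤ (roundMetric (n := n) (EuclideanSpace ℝ (Fin (n + 1)))).val x v v
    rw [roundMetric_apply_self]
    positivity
  have h2 : (0 : ℝ) ≤ (n : ℝ) - 1 := by
    have : (1 : ℝ) ≤ n := by exact_mod_cast hn
    linarith
  nlinarith

/-- **The model case of `CheegerColding1997_sphereStability` (consistency of its hypotheses).**
For `n ≥ 1` and every `ε ≥ 0`, the unit round sphere `Sⁿ ⊂ ℝⁿ⁺¹` with `roundSphereMetric n`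
satisfies the Ricci hypothesis `Ric ≥ −(n − 1) g` and the Gromov–Hausdorff hypothesis
(`∃ f, IsRoundSphereGHApprox n h ε f`, with `f = id`) of the fact, and — trivially — its
conclusion (`Diffeomorph.refl`). So the implication asserted by the fact is instantiated
non-vacuously by the space it is about. [folklore] -/
theorem CheegerColding1997_sphereStability_modelCase (hn : 1 ≤ n) {ε : ℝ} (hε : 0 ≤ ε) :
    (∀ (x : sphere (0 : EuclideanSpace ℝ (Fin (n + 1))) 1) (v : TangentSpace (𝓡 n) x),
        -((n : ℝ) - 1) * (roundSphereMetric n).inner x v v ≤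
          (ofRiemannian (roundSphereMetric n)).ricci x v v) ∧
      (∃ f : sphere (0 : EuclideanSpace ℝ (Fin (n + 1))) 1 →
          sphere (0 : EuclideanSpace ℝ (Fin (n + 1))) 1,
        IsRoundSphereGHApprox n (roundSphereMetric n) ε f) ∧
      Nonempty ((sphere (0 : EuclideanSpace ℝ (Fin (n + 1))) 1) ≃ₘ⟮𝓡 n, 𝓡 n⟯
        (sphere (0 : EuclideanSpace ℝ (Fin (n + 1))) 1)) :=
  ⟨ricci_roundSphereMetric_ge hn, ⟨id, IsRoundSphereGHApprox.mono (isRoundSphereGHApprox_roundSphere hn) hε⟩,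
    ⟨Diffeomorph.refl _ _ _⟩⟩

end ModelCase


/-! ### §6. From Mathlib's Gromov–Hausdorff distance back to `IsRoundSphereGHApprox` -/

/-- **`d_GH < ε` gives a `2ε`-approximation to the round sphere.** If the compact connected
Riemannian manifold `(M, d_h)` (metric space structure `metricSpaceOfRiemannian`) is at Mathlib
Gromov–Hausdorff distance `< ε` from `(Sⁿ, ∠)` (`GreatCircleSphere n`), then some
`f : M → Sⁿ` is a `2ε`-Gromov–Hausdorff approximation in the sense of `IsRoundSphereGHApprox`
(nearest points in an optimal common isometric embedding; `exists_approx_pair_of_ghDist_lt`).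
Converse of `IsRoundSphereGHApprox.ghDist_le` up to constants. [cite: Colding1997Aspects, Def. 2.1 and the remark following it] -/
theorem exists_isRoundSphereGHApprox_of_ghDist_lt {n : ℕ} {M : Type} [TopologicalSpace M]
    [T2Space M] [ChartedSpace (EuclideanSpace ℝ (Fin n)) M] [IsManifold (𝓡 n) ∞ M] [CompactSpace M]
    [ConnectedSpace M]
    (h : ContMDiffRiemannianMetric (𝓡 n) ∞ (EuclideanSpace ℝ (Fin n))
      (TangentSpace (𝓡 n) : M → Type _)) {ε : ℝ}
    (hgh : letI : RiemannianBundle (fun x : M ↦ TangentSpace (𝓡 n) x) :=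
        ⟨h.toContinuousRiemannianMetric.toRiemannianMetric⟩
      letI : MetricSpace M := metricSpaceOfRiemannian (𝓡 n) M
      GromovHausdorff.ghDist M (GreatCircleSphere n) < ε) :
    ∃ f : M → Metric.sphere (0 : EuclideanSpace ℝ (Fin (n + 1))) 1,
      IsRoundSphereGHApprox n h (2 * ε) f := by
  letI : RiemannianBundle (fun x : M ↦ TangentSpace (𝓡 n) x) :=
    ⟨h.toContinuousRiemannianMetric.toRiemannianMetric⟩
  letI : MetricSpace M := metricSpaceOfRiemannian (𝓡 n) M
  obtain ⟨f, g, hf, -, -, hfg⟩ := exists_approx_pair_of_ghDist_lt hgh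
  refine ⟨fun a ↦ GreatCircleSphere.ofSphere.symm (f a), fun a b ↦ ?_, fun y ↦ ?_⟩
  · have hab := hf a b
    rw [abs_sub_comm, GreatCircleSphere.dist_eq, dist_metricSpaceOfRiemannian] at hab
    exact hab
  · refine ⟨g (GreatCircleSphere.ofSphere y), ?_⟩
    have hy := hfg (GreatCircleSphere.ofSphere y)
    rw [GreatCircleSphere.dist_eq] at hy
    exact hy

end Literature.Geometry.Riemannian

end
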